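import Literature.MathematicalPhysics.QuantumFieldTheory.Balaban1983to89.B9Cor36GpDirEntriesAtField
import Literature.MathematicalPhysics.QuantumFieldTheory.Balaban1983to89.B9Cor36SiteSandwichTransferSrcGlobalBlocks
import Literature.MathematicalPhysics.QuantumFieldTheory.Balaban1983to89.B9Cor36GpCubeLocAtBlocks
import Literature.MathematicalPhysics.QuantumFieldTheory.Balaban1983to89.Node00.OpsYCubeKnitParCovariance

/-!
# `Balaban1983to89.B9Cor36GpDirAtMemberBlocks` — [Balaban1985BackgroundPropagators] Cor. 3.6 p. 408 ON ROAD P4, LAST STEP: «ALL THE RESULTS OF THESE THEOREMS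
# ARE GAUGE INVARIANT, SO THEY HOLD FOR THE CONFIGURATION U ALSO» — the four (3.42) entries of print's Dirichlet letter `G′_□(U) = Ω₀(padΔ_{□,Ω₀}(U))⁻¹Ω₀`
# at the RAW configuration `U`, with the derivatives `∇_U`, `∇*_U`, `Δ_U`, READ ON ALL THE MEMBER's BLOCKS (geometry `toB6 (geoBK i)`, key `Δ(·)`) — the
# literal shape of the heads' displayed row `h36b` — sub-row G-B9-LETTERS (site sector), seat dag-n06-c g32 UNIT 10

statement-level skeleton of published theorems with citation tags; proofs where landed; nothing here is a claim about the Yang–Mills mass gap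

CITATION HEADER (lean-in-tree rule).  B9 = T. Bałaban, *Propagators for lattice gauge theories in a background field*, Commun. Math. Phys. **99** (1985)
389–434 [Balaban1985BackgroundPropagators] (held `paper:balaban1985-cmp99-background-propagators`; journal page = PDF page + 388): Cor. 3.6 p. 408 l. 7–11
(«If a configuration U satisfies (3.35) with O(1)Mα₀ ≦ a₁, and Ω′₀ ⊂ □ for a cube □ of the class described in this condition, then Theorems 3.1–3.3 hold for the
operators G′(U), (Q′(U)G′²(U)Q′*(U))⁻¹, G(U) constructed for the sequence {Ω′_j}. This follows from Corollary 3.5 applied to the configuration U′ = Uᵘ, and we have to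
recall only that all the results of these theorems are gauge invariant.»); (3.28)–(3.33) pp. 395–396 («G(U^u) = R(u)G(U)R(u⁻¹)», «Δ_{U^u} = R(u)Δ_U R(u⁻¹)»); Thm 3.1 (3.42) p. 397 («for x ∈ Δ(y), … supp λ ⊂ Δ(y′), y, y′ ∈ 𝔅»); p. 409 l. 1–5 (the cube sequence's estimates read on the blocks of
`𝔅`).  [4] = [Balaban1984PropagatorsII] (2.51)–(2.55) p. 232, (2.45)–(2.46) p. 231.  Rows B9.Cor3.6 × B9.Thm3.1(3.42) (cells only; no row head changes).

WHY THIS FILE (road P4 of the N06 h36b campaign; UNITS 1–8 of this seat).  UNIT 8b (`B9Cor36GpDirEntriesAtField.gpDir_cube_entries_at_field`) is the four (3.42)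
entries of `O(Uᵘ) := G′_□(Uᵘ)` at the knit legs over the CUBE SEQUENCE's blocks.  The heads (n06-d «KESC-AβH» ✓p826126, «KE₁₄X-Aβ» ✓p826127; KDR) display the row
`h36b` at the RAW `U`, over the MEMBER's all-blocks geometry `toB6 (geoBY x) 1 (H x)` keyed by `blkOf`.  §1 is the covariance algebra: `G′_□(Uᵘ)R(u) = R(u)G′_□(U)`
(UNIT 3 `GpDirY_cov_of_pairs` + def-Y's `avgTrCubeY_parKnitCubeY_gaugeY`), `∇_{Uᵘ}R(u) = R(u)∇_U`, `Δ_{Uᵘ}R(u) = R(u)Δ_U` (E's `cdS_gaugeY`, `lapSL_cov`), whence each of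
the four words at `U` is a SANDWICH `M_1·R(u)⁻¹·[word at Uᵘ]·R(u)` of the source-global transfer lemma; §2 applies UNIT 9's
`B9Cor36SiteSandwichTransferSrcGlobalBlocks.hasMajorant_conj_site_sandwich_src_global_decay_blocks` (levels only grow, distances only shrink under coarsening
`𝔅_□ → 𝔅`; the member source block splits into cube blocks at the price of one (2.61) sum — `Ω₀(□)` is far larger than the hull where member blocks are cube
blocks, so NO nearness hypothesis on `Ω₀(□)` is wanted or used).
Output ★★★`gpDir_at_member_blocks`: `h36b`'s four clauses for `O := GpDirY i □ (parKnitCubeY i □) (dirDomY i □) U` with `η := (kGeo i).eta` (= `etaS`, ✓`etaS_eq_eta`),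
for every `[Fintype (geoBK i).Site] (Rr Hp)`, modulo the DISPLAYED (3.35) datum of `Ω₀(□)` (LOCATED-32), the collar geometry `hS2`, bi-contractive `u` and `Uᵘ`,
p06's window numerics.  The quoted sentence «so they hold for the configuration U also»
of earlier headers of this seat is a paraphrase; print's words are «we have to recall only that all the results of these theorems are gauge invariant» (p. 408 l. 11).

WHAT IS PROVED (0 `def`s; 0 sorry; 0 new named facts; standard axioms): §1 covariance algebra, §2 ★★★`gpDir_at_member_blocks`, §3 `hg_of_unitary`,
`hR_of_unitary` (the two bi-contractivity displays from unitarity).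
-/

noncomputable section

namespace Literature.MathematicalPhysics.QuantumFieldTheory.Balaban1983to89.B9Cor36GpDirAtMemberBlocks

open Literature.MathematicalPhysics.QuantumFieldTheory.Balaban1983to89
open Literature.MathematicalPhysics.QuantumFieldTheory.Balaban1983to89.B6RandomWalk (HasMajorant hasMajorant_mono hasMajorant_add c1_nonneg)
open Literature.MathematicalPhysics.QuantumFieldTheory.Balaban1983to89.B9Thm34Ext (toB6)
open Literature.MathematicalPhysics.QuantumFieldTheory.Balaban1983to89.B9Eq352DivFormLetters (conj gradLetterF_apply gradLetterB_apply)
open Literature.MathematicalPhysics.QuantumFieldTheory.Balaban1983to89.B9Eq352GradLetters (diffLetter diffLetter_inl diffLetter_inr)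
open Literature.MathematicalPhysics.QuantumFieldTheory.Balaban1983to89.B9Eq39Adjoint (R R_smul R_neg fluct covD covDstar)
open Literature.MathematicalPhysics.QuantumFieldTheory.Balaban1983to89.B6KLevelCensusIndexV1 (KIdx kGeo)
open Literature.MathematicalPhysics.QuantumFieldTheory.Balaban1983to89.B6Cover236MultiLevelBlocks (cubes)
open Literature.MathematicalPhysics.QuantumFieldTheory.Balaban1983to89.B6GlobalChartV1 (PV boxEquiv)
open Literature.MathematicalPhysics.QuantumFieldTheory.Balaban1983to89.B6Geom246MultiLevelBox (blkOf)
open Literature.MathematicalPhysics.QuantumFieldTheory.Balaban1983to89.B9BackgroundsKLevelV1 (shiftsV1)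
open Literature.MathematicalPhysics.QuantumFieldTheory.Balaban1983to89.B9Eq360DeltaPrimeAY (AfldY)
open Literature.MathematicalPhysics.QuantumFieldTheory.Balaban1983to89.B9Eq360DeltaPrimeACubeY (blkCubeY)
open Literature.MathematicalPhysics.QuantumFieldTheory.Balaban1983to89.B9CubeLettersOpsL0 (levCubeY avgCoeffCubeY avgTrCubeY)
open Literature.MathematicalPhysics.QuantumFieldTheory.Balaban1983to89.B9CubeGeometryInputs (geoCK RM1 N1 exists_h261_geoCK)
open Literature.MathematicalPhysics.QuantumFieldTheory.Balaban1983to89.B9Cor35GpDirInputsAtOne (dirDomY)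
open Literature.MathematicalPhysics.QuantumFieldTheory.Balaban1983to89.B9Cor36GpDirEntriesAtField (gpDir_cube_entries_at_field)
open Literature.MathematicalPhysics.QuantumFieldTheory.Balaban1983to89.B9Cor36GpCubeLocAtMember (hasMajorant_congr_op kernel_le)
open Literature.MathematicalPhysics.QuantumFieldTheory.Balaban1983to89.B9Cor36SiteSandwichTransferSrcGlobalBlocks (hasMajorant_conj_site_sandwich_src_global_decay_blocks)
open Literature.MathematicalPhysics.QuantumFieldTheory.Balaban1983to89.B9SectBAllBlocksGeometryY (geoBK geoBK_len_pos geoBK_dist_nonneg)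
open Literature.MathematicalPhysics.QuantumFieldTheory.Balaban1983to89.B9Cor36GCubeLocLetter (conjY_mul_conjY_inv_eq_one cutMulY_mul_conjY_eq)
open Literature.MathematicalPhysics.QuantumFieldTheory.Balaban1983to89.B9Thm37CubeCoverCommutators (cutMulY cutMulY_apply cutMulY_one)
open Literature.MathematicalPhysics.QuantumFieldTheory.Balaban1983to89.B9Eq360PadDeltaCubeY (GpDirY_cov_of_pairs)
open Literature.MathematicalPhysics.QuantumFieldTheory.Balaban1983to89.B7Prop2Explicit (C0 c2')
open Literature.MathematicalPhysics.QuantumFieldTheory.Balaban1983to89.B7Prop3Flat (c3)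
open Literature.MathematicalPhysics.QuantumFieldTheory.Balaban1983to89.Node00 (SiteY CfgY GaugeY SiteParY toKT shiftY gaugeY UboxY lapSL Intw conjY conjY_apply gSiteY
  cdS cdsS cdS_gaugeY cdsS_gaugeY lapSL_cov)
open Literature.MathematicalPhysics.QuantumFieldTheory.Balaban1983to89.Node00.OpsYLocalInverse (cubeProjY cubeProjY_apply cubeIndY)
open Literature.MathematicalPhysics.QuantumFieldTheory.Balaban1983to89.Node00.OpsYCubeDirInverse (padDeltaCubeY GpDirY GpDirY_mul_cubeProjY)
open Literature.MathematicalPhysics.QuantumFieldTheory.Balaban1983to89.Node00.OpsYCubeKnitPar (parKnitCubeY)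
open Literature.MathematicalPhysics.QuantumFieldTheory.Balaban1983to89.Node00.OpsYCubeKnitParCovariance (avgTrCubeY_parKnitCubeY_gaugeY)
open scoped Matrix

variable {d ℓ : ℕ} {hd : 1 ≤ d + 1} {hL : Odd (ℓ + 1) ∧ 1 < ℓ + 1} {b₀ b₁ : ℝ}

/-! ## §1  Gauge covariance of the four words: each word at `U` is the sandwich `R(u)⁻¹·[word at Uᵘ]·R(u)` of the cube-side word -/

section Cov

variable {𝔸 : Type} [NormedRing 𝔸] [NormedAlgebra ℂ 𝔸] [CompleteSpace 𝔸]
variable (i : KIdx d ℓ hd hL b₀ b₁) (g : GaugeY 𝔸 i) (U : CfgY 𝔸 i)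

/-- `R(u)·R(u⁻¹) = 1` on the real-linear letters. [cite: Balaban1985BackgroundPropagators, (3.28) p.395, bookkeeping] -/
theorem rs_conjY_mul_inv : ((conjY (gSiteY i g)).restrictScalars ℝ : Module.End ℝ (SiteY i → 𝔸)) * (conjY (gSiteY i g)⁻¹).restrictScalars ℝ = 1 := by
  refine LinearMap.ext fun f => ?_
  show ((conjY (gSiteY i g) : Module.End ℂ (SiteY i → 𝔸)) * conjY (gSiteY i g)⁻¹) f = f
  rw [conjY_mul_conjY_inv_eq_one]; rfl

/-- `R(u⁻¹)·R(u) = 1` on the real-linear letters. [cite: Balaban1985BackgroundPropagators, (3.28) p.395, bookkeeping] -/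
theorem rs_conjY_inv_mul : ((conjY (gSiteY i g)⁻¹).restrictScalars ℝ : Module.End ℝ (SiteY i → 𝔸)) * (conjY (gSiteY i g)).restrictScalars ℝ = 1 := by
  have h := conjY_mul_conjY_inv_eq_one (𝔸 := 𝔸) (gSiteY i g)⁻¹
  rw [inv_inv] at h
  refine LinearMap.ext fun f => ?_
  show ((conjY (gSiteY i g)⁻¹ : Module.End ℂ (SiteY i → 𝔸)) * conjY (gSiteY i g)) f = f
  rw [h]; rfl

/-- `R(u)·(R(u⁻¹)·X) = X`. [cite: Balaban1985BackgroundPropagators, (3.28) p.395, bookkeeping] -/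
theorem rs_conjY_cancel (X : Module.End ℝ (SiteY i → 𝔸)) :
    ((conjY (gSiteY i g)).restrictScalars ℝ : Module.End ℝ (SiteY i → 𝔸)) * ((conjY (gSiteY i g)⁻¹).restrictScalars ℝ * X) = X := by
  rw [← mul_assoc, rs_conjY_mul_inv, one_mul]

/-- an intertwining relation `L′R(u) = R(u)L` read as `L = R(u⁻¹)L′R(u)` on the real-linear letters. [cite: Balaban1985BackgroundPropagators, (3.31)–(3.33) p.395] -/
theorem rs_eq_of_intw {L L' : Module.End ℂ (SiteY i → 𝔸)} (h : Intw (conjY (gSiteY i g)) (conjY (gSiteY i g)) L L') :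
    (L.restrictScalars ℝ : Module.End ℝ (SiteY i → 𝔸)) =
      (conjY (gSiteY i g)⁻¹).restrictScalars ℝ * L'.restrictScalars ℝ * (conjY (gSiteY i g)).restrictScalars ℝ := by
  have h' : (L'.restrictScalars ℝ : Module.End ℝ (SiteY i → 𝔸)) * (conjY (gSiteY i g)).restrictScalars ℝ =
      (conjY (gSiteY i g)).restrictScalars ℝ * L.restrictScalars ℝ :=
    LinearMap.ext fun f => congrArg (fun T : (SiteY i → 𝔸) →ₗ[ℂ] (SiteY i → 𝔸) => T f) h
  rw [mul_assoc, h', ← mul_assoc, rs_conjY_inv_mul, one_mul]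

/-- ★ **(3.33) FOR PRINT's DIRICHLET LETTER AT THE KNIT LEGS**: `G′_□(U) = R(u⁻¹)G′_□(Uᵘ)R(u)` (UNIT 3's covariance + def-Y's contour law of `parKnitCubeY`).
[cite: Balaban1985BackgroundPropagators, (3.33) p.396 («G(U^u) = R(u)G(U)R(u⁻¹)»), Cor. 3.6 p.408 l.11–14] -/
theorem GpDirY_rs_eq (c : ↥(cubes (toKT i).D.toDomains)) (S : Finset (SiteY i)) :
    ((GpDirY i c (parKnitCubeY i c) S U).restrictScalars ℝ : Module.End ℝ (SiteY i → 𝔸)) =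
      (conjY (gSiteY i g)⁻¹).restrictScalars ℝ * (GpDirY i c (parKnitCubeY i c) S (gaugeY i g U)).restrictScalars ℝ *
        (conjY (gSiteY i g)).restrictScalars ℝ :=
  rs_eq_of_intw i g (GpDirY_cov_of_pairs c g U S fun _ _ hzw => avgTrCubeY_parKnitCubeY_gaugeY i c g U hzw)

/-- **(3.31) for `Δ_U`** on the real-linear letters: `Δ_U = R(u⁻¹)Δ_{Uᵘ}R(u)`. [cite: Balaban1985BackgroundPropagators, (3.31) p.395] -/
theorem lapSL_rs_eq : ((lapSL i U).restrictScalars ℝ : Module.End ℝ (SiteY i → 𝔸)) =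
    (conjY (gSiteY i g)⁻¹).restrictScalars ℝ * (lapSL i (gaugeY i g U)).restrictScalars ℝ * (conjY (gSiteY i g)).restrictScalars ℝ :=
  rs_eq_of_intw i g (lapSL_cov i g U)

/-- **(3.31) for the directional letters**: `∇_{Uᵘ,k}R(u) = R(u)∇_{U,k}` (both orientations). [cite: Balaban1985BackgroundPropagators, (3.3) p.390, (3.8) p.392, (3.31) p.395] -/
theorem diffLetter_mul_conjY (cc : ℂ) (k : Fin (d + 1) ⊕ Fin (d + 1)) :
    diffLetter (shiftY i) (UboxY i (gaugeY i g U)) cc k * (conjY (gSiteY i g)).restrictScalars ℝ =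
      (conjY (gSiteY i g)).restrictScalars ℝ * diffLetter (shiftY i) (UboxY i U) cc k := by
  refine LinearMap.ext fun f => funext fun z => ?_
  rcases k with μ | μ
  · show cc • cdS i (gaugeY i g U) μ (conjY (gSiteY i g) f) z = R (gSiteY i g z) (cc • cdS i U μ f z)
    rw [cdS_gaugeY, R_smul]
  · show -(cc • cdsS i (gaugeY i g U) μ (conjY (gSiteY i g) f) z) = R (gSiteY i g z) (-(cc • cdsS i U μ f z))
    rw [cdsS_gaugeY, R_neg, R_smul]

/-- hence `∇_{U,k} = R(u⁻¹)∇_{Uᵘ,k}R(u)`. [cite: Balaban1985BackgroundPropagators, (3.31) p.395] -/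
theorem diffLetter_eq_conj (cc : ℂ) (k : Fin (d + 1) ⊕ Fin (d + 1)) :
    diffLetter (shiftY i) (UboxY i U) cc k =
      (conjY (gSiteY i g)⁻¹).restrictScalars ℝ * diffLetter (shiftY i) (UboxY i (gaugeY i g U)) cc k * (conjY (gSiteY i g)).restrictScalars ℝ := by
  rw [mul_assoc, diffLetter_mul_conjY, ← mul_assoc, rs_conjY_inv_mul, one_mul]

/-- a real cut-off commutes with `R(u)` (real-linear letters). [cite: Balaban1985BackgroundPropagators, (3.28) p.395, bookkeeping] -/
theorem rs_cutMulY_mul_conjY (χ : SiteY i → ℝ) :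
    ((cutMulY (𝔸 := 𝔸) χ).restrictScalars ℝ : Module.End ℝ (SiteY i → 𝔸)) * (conjY (gSiteY i g)).restrictScalars ℝ =
      (conjY (gSiteY i g)).restrictScalars ℝ * (cutMulY (𝔸 := 𝔸) χ).restrictScalars ℝ := by
  have h := cutMulY_mul_conjY_eq (𝔸 := 𝔸) (gSiteY i g) χ
  refine LinearMap.ext fun f => ?_
  exact congrArg (fun T : Module.End ℂ (SiteY i → 𝔸) => T f) h

/-- `G′_□ = G′_□·Ω₀` on the real-linear letters (`Ω₀ = M_{𝟙_S}`). [cite: Balaban1985BackgroundPropagators, p.394 («Ω₀Δ′_aΩ₀»), bookkeeping] -/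
theorem GpDirY_rs_mul_ind (c : ↥(cubes (toKT i).D.toDomains)) (par : SiteParY 𝔸 i) (S : Finset (SiteY i)) (V : CfgY 𝔸 i) :
    ((GpDirY i c par S V).restrictScalars ℝ : Module.End ℝ (SiteY i → 𝔸)) * (cutMulY (𝔸 := 𝔸) (cubeIndY i S)).restrictScalars ℝ =
      (GpDirY i c par S V).restrictScalars ℝ := by
  show ((GpDirY i c par S V * cubeProjY i S).restrictScalars ℝ : Module.End ℝ (SiteY i → 𝔸)) = _
  rw [GpDirY_mul_cubeProjY]

omit [CompleteSpace 𝔸] in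
/-- the unit cut-off is the identity letter. [cite: Balaban1985BackgroundPropagators, (3.87) p.409, bookkeeping] -/
theorem rs_cutMulY_one : ((cutMulY (𝔸 := 𝔸) (fun _ : SiteY i => (1 : ℝ))).restrictScalars ℝ : Module.End ℝ (SiteY i → 𝔸)) = 1 := by
  rw [cutMulY_one]; exact LinearMap.ext fun _ => rfl

variable (c : ↥(cubes (toKT i).D.toDomains)) (S : Finset (SiteY i))

/-- ★ **(3.42)₁-WORD AS A SANDWICH**: `η²G′_□(U) = M_1·R(u⁻¹)·(η²G′_□(Uᵘ))·R(u)`. [cite: Balaban1985BackgroundPropagators, (3.33) p.396, Cor. 3.6 p.408 l.10–11] -/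
theorem sandwich_O (η : ℝ) :
    (cutMulY (𝔸 := 𝔸) (fun _ : SiteY i => (1 : ℝ))).restrictScalars ℝ ∘ₗ (conjY (gSiteY i g)⁻¹).restrictScalars ℝ ∘ₗ
        ((η ^ 2) • (GpDirY i c (parKnitCubeY i c) S (gaugeY i g U)).restrictScalars ℝ) ∘ₗ (conjY (gSiteY i g)).restrictScalars ℝ =
      (η ^ 2) • (GpDirY i c (parKnitCubeY i c) S U).restrictScalars ℝ := by
  show (cutMulY (𝔸 := 𝔸) (fun _ : SiteY i => (1 : ℝ))).restrictScalars ℝ * ((conjY (gSiteY i g)⁻¹).restrictScalars ℝ *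
      (((η ^ 2) • (GpDirY i c (parKnitCubeY i c) S (gaugeY i g U)).restrictScalars ℝ) * (conjY (gSiteY i g)).restrictScalars ℝ)) = _
  rw [rs_cutMulY_one, one_mul, GpDirY_rs_eq i g U c S]
  simp only [smul_mul_assoc, mul_smul_comm, mul_assoc]

/-- ★ **(3.42)₂-WORD AS A SANDWICH**: `∇_{U,k}·η²G′_□(U) = M_1·R(u⁻¹)·(∇_{Uᵘ,k}·η²G′_□(Uᵘ))·R(u)`. [cite: Balaban1985BackgroundPropagators, (3.31), (3.33) p.395–396, Cor. 3.6 p.408] -/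
theorem sandwich_diffLetter_O (η : ℝ) (cc : ℂ) (k : Fin (d + 1) ⊕ Fin (d + 1)) :
    (cutMulY (𝔸 := 𝔸) (fun _ : SiteY i => (1 : ℝ))).restrictScalars ℝ ∘ₗ (conjY (gSiteY i g)⁻¹).restrictScalars ℝ ∘ₗ
        (diffLetter (shiftY i) (UboxY i (gaugeY i g U)) cc k * ((η ^ 2) • (GpDirY i c (parKnitCubeY i c) S (gaugeY i g U)).restrictScalars ℝ)) ∘ₗ
          (conjY (gSiteY i g)).restrictScalars ℝ =
      diffLetter (shiftY i) (UboxY i U) cc k * ((η ^ 2) • (GpDirY i c (parKnitCubeY i c) S U).restrictScalars ℝ) := by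
  show (cutMulY (𝔸 := 𝔸) (fun _ : SiteY i => (1 : ℝ))).restrictScalars ℝ * ((conjY (gSiteY i g)⁻¹).restrictScalars ℝ *
      ((diffLetter (shiftY i) (UboxY i (gaugeY i g U)) cc k * ((η ^ 2) • (GpDirY i c (parKnitCubeY i c) S (gaugeY i g U)).restrictScalars ℝ)) *
        (conjY (gSiteY i g)).restrictScalars ℝ)) = _
  rw [rs_cutMulY_one, one_mul, GpDirY_rs_eq i g U c S, diffLetter_eq_conj i g U cc k]
  simp only [smul_mul_assoc, mul_smul_comm, mul_assoc, rs_conjY_cancel]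

/-- ★ **(3.42)₃-WORD AS A SANDWICH**: `η²G′_□(U)·(−∇*_{U,μ}) = M_1·R(u⁻¹)·(η²G′_□(Uᵘ)·(−∇*_{Uᵘ,μ}))·R(u)`. [cite: Balaban1985BackgroundPropagators, (3.31), (3.33) p.395–396, Cor. 3.6 p.408] -/
theorem sandwich_O_diffLetter (η : ℝ) (cc : ℂ) (k : Fin (d + 1) ⊕ Fin (d + 1)) :
    (cutMulY (𝔸 := 𝔸) (fun _ : SiteY i => (1 : ℝ))).restrictScalars ℝ ∘ₗ (conjY (gSiteY i g)⁻¹).restrictScalars ℝ ∘ₗ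
        (((η ^ 2) • (GpDirY i c (parKnitCubeY i c) S (gaugeY i g U)).restrictScalars ℝ) * diffLetter (shiftY i) (UboxY i (gaugeY i g U)) cc k) ∘ₗ
          (conjY (gSiteY i g)).restrictScalars ℝ =
      ((η ^ 2) • (GpDirY i c (parKnitCubeY i c) S U).restrictScalars ℝ) * diffLetter (shiftY i) (UboxY i U) cc k := by
  show (cutMulY (𝔸 := 𝔸) (fun _ : SiteY i => (1 : ℝ))).restrictScalars ℝ * ((conjY (gSiteY i g)⁻¹).restrictScalars ℝ *
      ((((η ^ 2) • (GpDirY i c (parKnitCubeY i c) S (gaugeY i g U)).restrictScalars ℝ) * diffLetter (shiftY i) (UboxY i (gaugeY i g U)) cc k) *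
        (conjY (gSiteY i g)).restrictScalars ℝ)) = _
  rw [rs_cutMulY_one, one_mul, GpDirY_rs_eq i g U c S, diffLetter_eq_conj i g U cc k]
  simp only [smul_mul_assoc, mul_smul_comm, mul_assoc, rs_conjY_cancel]

/-- ★ **(3.42)₄-WORD AS A SANDWICH**: `η⁻²Δ_U·η²G′_□(U) = M_1·R(u⁻¹)·(η⁻²Δ_{Uᵘ}·η²G′_□(Uᵘ))·R(u)`. [cite: Balaban1985BackgroundPropagators, (3.31), (3.33) p.395–396, Cor. 3.6 p.408] -/
theorem sandwich_lapSL_O (η : ℝ) :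
    (cutMulY (𝔸 := 𝔸) (fun _ : SiteY i => (1 : ℝ))).restrictScalars ℝ ∘ₗ (conjY (gSiteY i g)⁻¹).restrictScalars ℝ ∘ₗ
        ((((η ^ 2)⁻¹ : ℝ) • (lapSL i (gaugeY i g U)).restrictScalars ℝ) * ((η ^ 2) • (GpDirY i c (parKnitCubeY i c) S (gaugeY i g U)).restrictScalars ℝ)) ∘ₗ
          (conjY (gSiteY i g)).restrictScalars ℝ =
      (((η ^ 2)⁻¹ : ℝ) • (lapSL i U).restrictScalars ℝ) * ((η ^ 2) • (GpDirY i c (parKnitCubeY i c) S U).restrictScalars ℝ) := by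
  show (cutMulY (𝔸 := 𝔸) (fun _ : SiteY i => (1 : ℝ))).restrictScalars ℝ * ((conjY (gSiteY i g)⁻¹).restrictScalars ℝ *
      (((((η ^ 2)⁻¹ : ℝ) • (lapSL i (gaugeY i g U)).restrictScalars ℝ) * ((η ^ 2) • (GpDirY i c (parKnitCubeY i c) S (gaugeY i g U)).restrictScalars ℝ)) *
        (conjY (gSiteY i g)).restrictScalars ℝ)) = _
  rw [rs_cutMulY_one, one_mul, GpDirY_rs_eq i g U c S, lapSL_rs_eq i g U]
  simp only [smul_mul_assoc, mul_smul_comm, mul_assoc, rs_conjY_cancel]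

end Cov

/-! ## §2  ★★★ The four (3.42) entries of `G′_□(U)` at the raw `U`, on all the member's blocks — the `h36b` shape -/

section Main

open scoped Matrix.Norms.L2Operator

variable {N : ℕ} [Nonempty (Fin N)]
variable {ι : Type} [Fintype ι] [DecidableEq ι] (b : Module.Basis ι ℝ (Matrix (Fin N) (Fin N) ℂ))

set_option maxHeartbeats 800000 in
/-- ★★★ **COROLLARY 3.6 AT ONE COVER CUBE ON ROAD P4, READ ON ALL THE MEMBER's BLOCKS — THE FOUR (3.42) BLOCK MAJORANTS OF `η²G′_□(U)` WITH THE MEMBER's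
DERIVATIVES AT THE RAW `U`, KEYED BY `Δ(·)`**: there are `δ > 0`, `B_m ≥ 0`, thresholds `M₀, T₀, N₀` and `a₁ > 0` (functions of `d, L, M₂, Σ‖b_j‖`) such that for every
member above the thresholds, every cover cube `□`, every (3.35) datum `(u, A)` on `Q ⊇ chart⁻¹Ω₀(□)` as in UNIT 7 (`Uᵘ = e^{iηA}` on the bonds of `Q`, `‖A‖ ≤ Cξ⁻¹`,
`‖η⁻¹∂A‖ ≤ Cξ⁻²`, `η ≤ ξ`, `L^{n+1}η ≤ Λξ`, collar geometry `hS2`, `2CΛ² ≤ min(a₁, ¼)`, p06's numerics), bi-contractive `u` and `Uᵘ`, and every walk datum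
`(Rr, Hp)` of the all-blocks geometry: `padΔ_{□,Ω₀}(Uᵘ)` is a unit and, with `O := G′_□(U) = GpDirY i □ (parKnitCubeY i □) Ω₀(□) U`,
over `toB6 (geoBK i) Rr Hp` keyed by `(z, j) ↦ Δ(z)`: `conj b(η²O) ≺ B_mℓ(a)²e^{−δd}`, `conj b(∇_{U,μ}η⁻¹)·conj b(η²O) ≺ B_mℓ(a)e^{−δd}`, `conj b(η²O)·conj b(−∇*_{U,μ}η⁻¹)
≺ B_mℓ(a)e^{−δd}`, `conj b(η⁻²Δ_U)·conj b(η²O) ≺ B_m·1·e^{−δd}` — print's «all the results of these theorems are gauge invariant, so they hold for the configuration U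
also», in the shape of the heads' displayed row `h36b` (with `η = (kGeo i).eta = etaS`).
[cite: Balaban1985BackgroundPropagators, Cor. 3.6 p.408 l.1–14, (3.28)–(3.33) pp.395–396, Thm 3.1 (3.42) p.397, p.409 l.1–5, Thm 3.4 p.400; Balaban1984PropagatorsII, (2.51)–(2.55) p.232, (2.45)–(2.46) p.231] -/
theorem gpDir_at_member_blocks (d ℓ : ℕ) (hℓ : 1 ≤ ℓ) (M₂ : ℝ) (hM₂ : 0 ≤ M₂) (hrepr : ∀ (v : Matrix (Fin N) (Fin N) ℂ) (j : ι), |b.repr v j| ≤ M₂ * ‖v‖) :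
    ∃ δ Bm M₀ T₀ : ℝ, ∃ N₀ : ℕ, 0 < δ ∧ 0 ≤ Bm ∧ ∃ a₁ : ℝ, 0 < a₁ ∧
    ∀ {hd : 1 ≤ d + 1} {hL : Odd (ℓ + 1) ∧ 1 < ℓ + 1} {b₀ b₁ : ℝ} (i : KIdx d ℓ hd hL b₀ b₁) (c : ↥(cubes (toKT i).D.toDomains)),
      M₀ ≤ ((ℓ : ℝ) + 1) * (toKT i).Mh → N₀ + 1 ≤ (toKT i).R * ((ℓ + 1) * (toKT i).Mh) → T₀ ≤ RM1 i →
    ∀ (g : GaugeY (Matrix (Fin N) (Fin N) ℂ) i) (U : CfgY (Matrix (Fin N) (Fin N) ℂ) i) (A : AfldY (Matrix (Fin N) (Fin N) ℂ) i)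
      (Q : Set (Site (PV d ℓ i.m i.K hd hL) 0)) (C ξ Λ α₀' : ℝ),
      0 ≤ C → (kGeo i).eta ≤ ξ → 1 ≤ Λ → LatticeNorms.scaleLen ((ℓ : ℝ) + 1) (kGeo i).eta (c.1.1 + 1) ≤ Λ * ξ →
      (∀ z ∈ dirDomY i c, (boxEquiv i.hN).symm z ∈ Q) →
      (∀ (κ : Fin (d + 1)) (x : Site (PV d ℓ i.m i.K hd hL) 0), x ∈ Q → x.shift κ ∈ Q → gaugeY i g U κ x = fluct (kGeo i).eta A κ x) →
      (∀ κ, ∀ x ∈ Q, ‖A κ x‖ ≤ C * ξ⁻¹) →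
      (∀ μ ν, ∀ x ∈ Q, ‖(((kGeo i).eta : ℂ)⁻¹) • covD (shiftsV1 (PV d ℓ i.m i.K hd hL)) (fun _ _ => (1 : (Matrix (Fin N) (Fin N) ℂ)ˣ)) μ (A ν) x‖ ≤ C * (ξ ^ 2)⁻¹) →
      (∀ z : SiteY i, 1 ≤ levCubeY i c z → z ∈ dirDomY i c ∧ ∀ μ, shiftY i μ z ∈ dirDomY i c ∧ (shiftY i μ).symm z ∈ dirDomY i c ∧
        ∀ ν, shiftY i ν (shiftY i μ z) ∈ dirDomY i c ∧ shiftY i ν ((shiftY i μ).symm z) ∈ dirDomY i c ∧ (shiftY i ν).symm ((shiftY i μ).symm z) ∈ dirDomY i c) →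
      2 * C * Λ ^ 2 ≤ a₁ → 2 * C * Λ ^ 2 ≤ 1 / 4 →
      0 < α₀' → C0 (d + 1) * α₀' ≤ 1 / 3 → 4 * α₀' ≤ c2' (d + 1) (ℓ + 1) →
      Real.exp (4 * (800 * (((d + 1 : ℕ) : ℝ) + 1) ^ 2 * (((d + 1 : ℕ) : ℝ) + 4)) * α₀') * (1 + 8 * (131072 * (((d + 1 : ℕ) : ℝ) + 1) ^ 2) * (2 * C * Λ ^ 2)) ≤ 2 →
      2 * (2 * C * Λ ^ 2) ≤ c3 (d + 1) (ℓ + 1) → 4096 * ((d + 1 : ℕ) : ℝ) * (2 * C * Λ ^ 2) ≤ 1 →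
      (∀ (μ : Fin (d + 1)) (z : SiteY i) (a : Matrix (Fin N) (Fin N) ℂ),
        ‖R (UboxY i (gaugeY i g U) μ z) a‖ ≤ ‖a‖ ∧ ‖R (UboxY i (gaugeY i g U) μ z)⁻¹ a‖ ≤ ‖a‖) →
      (∀ x, ‖((g x : (Matrix (Fin N) (Fin N) ℂ)ˣ) : Matrix (Fin N) (Fin N) ℂ)‖ ≤ 1 ∧ ‖(((g x)⁻¹ : (Matrix (Fin N) (Fin N) ℂ)ˣ) : Matrix (Fin N) (Fin N) ℂ)‖ ≤ 1) →
    ∀ [Fintype (geoBK i).Site] (Rr : ℝ) (Hp : Prop),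
      IsUnit (padDeltaCubeY i c (parKnitCubeY i c) (dirDomY i c) (gaugeY i g U)) ∧
      HasMajorant (g := toB6 (geoBK i) Rr Hp) (fun p : SiteY i × ι => blkOf i.D.toDomains p.1)
        (conj b (((kGeo i).eta ^ 2) • (GpDirY i c (parKnitCubeY i c) (dirDomY i c) U).restrictScalars ℝ))
        (fun a a' => Bm * (geoBK i).len a ^ 2 * Real.exp (-(δ * (geoBK i).dist a a'))) ∧
      (∀ μ : Fin (d + 1), HasMajorant (g := toB6 (geoBK i) Rr Hp) (fun p : SiteY i × ι => blkOf i.D.toDomains p.1)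
        (conj b (diffLetter (shiftY i) (UboxY i U) ((((kGeo i).eta : ℂ))⁻¹) (Sum.inl μ)) *
          conj b (((kGeo i).eta ^ 2) • (GpDirY i c (parKnitCubeY i c) (dirDomY i c) U).restrictScalars ℝ))
        (fun a a' => Bm * (geoBK i).len a * Real.exp (-(δ * (geoBK i).dist a a')))) ∧
      (∀ μ : Fin (d + 1), HasMajorant (g := toB6 (geoBK i) Rr Hp) (fun p : SiteY i × ι => blkOf i.D.toDomains p.1)
        (conj b (((kGeo i).eta ^ 2) • (GpDirY i c (parKnitCubeY i c) (dirDomY i c) U).restrictScalars ℝ) *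
          conj b (diffLetter (shiftY i) (UboxY i U) ((((kGeo i).eta : ℂ))⁻¹) (Sum.inr μ)))
        (fun a a' => Bm * (geoBK i).len a * Real.exp (-(δ * (geoBK i).dist a a')))) ∧
      HasMajorant (g := toB6 (geoBK i) Rr Hp) (fun p : SiteY i × ι => blkOf i.D.toDomains p.1)
        (conj b ((((kGeo i).eta ^ 2)⁻¹ : ℝ) • (lapSL i U).restrictScalars ℝ) *
          conj b (((kGeo i).eta ^ 2) • (GpDirY i c (parKnitCubeY i c) (dirDomY i c) U).restrictScalars ℝ))
        (fun a a' => Bm * 1 * Real.exp (-(δ * (geoBK i).dist a a'))) := by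
  letI : CStarAlgebra (Matrix (Fin N) (Fin N) ℂ) := {}
  have hSb : 0 ≤ ∑ j, ‖b j‖ := Finset.sum_nonneg fun _ _ => norm_nonneg _
  obtain ⟨δ, Bf, M₀, T₀, N₀, hδ, hBf, a₁, ha₁, Hc⟩ := gpDir_cube_entries_at_field b d ℓ hℓ M₂ hM₂ hrepr
  -- one (2.61) sum on the cube geometry at the splitting exponent `1/20`
  obtain ⟨dB, h261⟩ := exists_h261_geoCK d ℓ hδ
  set Bm : ℝ := (M₂ * ∑ j, ‖b j‖) ^ 2 * (1 * Bf * B6.c1 dB δ (1 / 20)) with hBmdef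
  have hBm : 0 ≤ Bm := by rw [hBmdef]; have := c1_nonneg dB δ (1 / 20); positivity
  refine ⟨(1 - 1 / 20) * δ, Bm, M₀, T₀, max N₀ (N1 d ℓ (9 / 5000 * δ)), by positivity, hBm, a₁, ha₁, ?_⟩
  intro hd hL b₀ b₁ i c hM hN hT g U A Q C ξ Λ α₀' hC hξ hΛ hΛξ hQ hgA hA hdA hS2 hα₁ hα4 hα' hα3 hα4' hsmall hc₃ hsm hR hg _ Rr Hp
  have hN₀ : N₀ + 1 ≤ (toKT i).R * ((ℓ + 1) * (toKT i).Mh) := le_trans (Nat.succ_le_succ (le_max_left _ _)) hN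
  have hNδ : N1 d ℓ (9 / 5000 * δ) + 1 ≤ (toKT i).R * ((ℓ + 1) * (toKT i).Mh) := le_trans (Nat.succ_le_succ (le_max_right _ _)) hN
  obtain ⟨hunit, E1, E2, E3, E4⟩ := Hc i c Rr Hp hM hN₀ hT g U A Q C ξ Λ α₀' hC hξ hΛ hΛξ hQ hgA hA hdA hS2 hα₁ hα4 hα' hα3 hα4' hsmall hc₃ hsm hR
  refine ⟨hunit, ?_⟩
  have h261' := h261 i c Rr Hp hNδ (1 / 20) (by norm_num) (by norm_num)
  set η : ℝ := (kGeo i).eta with hηdef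
  set S := dirDomY i c with hSdef
  set V := gaugeY i g U with hVdef
  set par := parKnitCubeY (𝔸 := Matrix (Fin N) (Fin N) ℂ) i c with hpardef
  -- the transfer inputs
  have hγ : ∀ (z : SiteY i) (a : Matrix (Fin N) (Fin N) ℂ), ‖R (gSiteY i g z) a‖ ≤ ‖a‖ ∧ ‖R (gSiteY i g z)⁻¹ a‖ ≤ ‖a‖ := fun z a =>
    ⟨B9Eq310Hermitian.norm_R_le (hg _).1 (hg _).2 a, B9Eq310Hermitian.norm_R_inv_le (hg _).1 (hg _).2 a⟩
  have h1w : ∀ z : SiteY i, |(fun _ : SiteY i => (1 : ℝ)) z| * (geoCK i c).len (blkCubeY i c z) ^ 0 ≤ 1 := fun z => by simp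
  have hl : ∀ a : (geoBK i).Site, 0 ≤ (geoBK i).len a := fun a => (geoBK_len_pos i a).le
  -- the cube entries in the form `conj b (word)` with `len ^ n`
  have E2' : ∀ μ : Fin (d + 1), HasMajorant (g := toB6 (geoCK i c) Rr Hp) (fun p : SiteY i × ι => blkCubeY i c p.1)
      (conj b (diffLetter (shiftY i) (UboxY i V) (((η : ℂ))⁻¹) (Sum.inl μ) * ((η ^ 2) • (GpDirY i c par S V).restrictScalars ℝ)))
      (fun a a' => Bf * (geoCK i c).len a ^ 1 * Real.exp (-(δ * (geoCK i c).dist a a'))) := fun μ => by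
    simpa only [pow_one, B9Eq352DivFormLetters.conj_mul] using E2 μ
  have E3' : ∀ μ : Fin (d + 1), HasMajorant (g := toB6 (geoCK i c) Rr Hp) (fun p : SiteY i × ι => blkCubeY i c p.1)
      (conj b (((η ^ 2) • (GpDirY i c par S V).restrictScalars ℝ) * diffLetter (shiftY i) (UboxY i V) (((η : ℂ))⁻¹) (Sum.inr μ)))
      (fun a a' => Bf * (geoCK i c).len a ^ 1 * Real.exp (-(δ * (geoCK i c).dist a a'))) := fun μ => by
    simpa only [pow_one, B9Eq352DivFormLetters.conj_mul] using E3 μ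
  have E4' : HasMajorant (g := toB6 (geoCK i c) Rr Hp) (fun p : SiteY i × ι => blkCubeY i c p.1)
      (conj b (((((η ^ 2)⁻¹ : ℝ)) • (lapSL i V).restrictScalars ℝ) * ((η ^ 2) • (GpDirY i c par S V).restrictScalars ℝ)))
      (fun a a' => Bf * (geoCK i c).len a ^ 0 * Real.exp (-(δ * (geoCK i c).dist a a'))) := by
    simpa only [pow_zero, B9Eq352DivFormLetters.conj_mul] using E4
  refine ⟨?_, fun μ => ?_, fun μ => ?_, ?_⟩
  · -- (3.42)₁
    have T := hasMajorant_conj_site_sandwich_src_global_decay_blocks i c b hM₂ hrepr (gSiteY i g) hγ (fun _ => (1 : ℝ)) (c₁ := 1) zero_le_one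
      (m := 0) (n := 2) (by norm_num) h1w Rr Hp Rr Hp dB hBf hδ.le (by norm_num : (1 : ℝ) / 20 ≤ 1) h261' _ E1
    refine hasMajorant_mono (g := toB6 (geoBK i) Rr Hp) _ (hasMajorant_congr_op T (by rw [sandwich_O i g U c S η])) fun a a' => ?_
    exact kernel_le (geoBK_dist_nonneg i a a') (pow_nonneg (hl a) _) (le_of_eq (by norm_num)) le_rfl hBm le_rfl
  · -- (3.42)₂
    have T := hasMajorant_conj_site_sandwich_src_global_decay_blocks i c b hM₂ hrepr (gSiteY i g) hγ (fun _ => (1 : ℝ)) (c₁ := 1) zero_le_one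
      (m := 0) (n := 1) (by norm_num) h1w Rr Hp Rr Hp dB hBf hδ.le (by norm_num : (1 : ℝ) / 20 ≤ 1) h261' _ (E2' μ)
    refine hasMajorant_mono (g := toB6 (geoBK i) Rr Hp) _
      (hasMajorant_congr_op T (by rw [sandwich_diffLetter_O i g U c S η _ (Sum.inl μ), B9Eq352DivFormLetters.conj_mul])) fun a a' => ?_
    exact kernel_le (geoBK_dist_nonneg i a a') (pow_nonneg (hl a) _) (le_of_eq (by norm_num)) le_rfl hBm le_rfl
  · -- (3.42)₃
    have T := hasMajorant_conj_site_sandwich_src_global_decay_blocks i c b hM₂ hrepr (gSiteY i g) hγ (fun _ => (1 : ℝ)) (c₁ := 1) zero_le_one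
      (m := 0) (n := 1) (by norm_num) h1w Rr Hp Rr Hp dB hBf hδ.le (by norm_num : (1 : ℝ) / 20 ≤ 1) h261' _ (E3' μ)
    refine hasMajorant_mono (g := toB6 (geoBK i) Rr Hp) _
      (hasMajorant_congr_op T (by rw [sandwich_O_diffLetter i g U c S η _ (Sum.inr μ), B9Eq352DivFormLetters.conj_mul])) fun a a' => ?_
    exact kernel_le (geoBK_dist_nonneg i a a') (pow_nonneg (hl a) _) (le_of_eq (by norm_num)) le_rfl hBm le_rfl
  · -- (3.42)₄
    have T := hasMajorant_conj_site_sandwich_src_global_decay_blocks i c b hM₂ hrepr (gSiteY i g) hγ (fun _ => (1 : ℝ)) (c₁ := 1) zero_le_one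
      (m := 0) (n := 0) le_rfl h1w Rr Hp Rr Hp dB hBf hδ.le (by norm_num : (1 : ℝ) / 20 ≤ 1) h261' _ E4'
    refine hasMajorant_mono (g := toB6 (geoBK i) Rr Hp) _
      (hasMajorant_congr_op T (by rw [sandwich_lapSL_O i g U c S η, B9Eq352DivFormLetters.conj_mul])) fun a a' => ?_
    exact kernel_le (geoBK_dist_nonneg i a a') (pow_nonneg (hl a) _) (le_of_eq (by norm_num)) le_rfl hBm le_rfl

end Main

/-! ## §3  The bi-contractivity displays from G-valuedness (unitary groups) -/

section Unitary

open scoped Matrix.Norms.L2Operator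
open Literature.MathematicalPhysics.QuantumFieldTheory.Balaban1983to89.B7Prop2Explicit (unitaryUnits unitaryUnits_le_U1)
open Literature.MathematicalPhysics.QuantumFieldTheory.Balaban1983to89.B9B8KnitAveragingClosenessOfColumns (norm_R_le_of_mem_unitaryUnits)

variable {N : ℕ} [Nonempty (Fin N)]

/-- **`hg` FROM UNITARITY**: a unitary-valued gauge transformation is a bi-contraction. [cite: Balaban1985BackgroundPropagators, (3.28) p.395, (3.35) p.396 (G-valued), bookkeeping] -/
theorem hg_of_unitary (i : KIdx d ℓ hd hL b₀ b₁) {g : GaugeY (Matrix (Fin N) (Fin N) ℂ) i} (hu : ∀ x, g x ∈ unitaryUnits (Matrix (Fin N) (Fin N) ℂ)) :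
    ∀ x, ‖((g x : (Matrix (Fin N) (Fin N) ℂ)ˣ) : Matrix (Fin N) (Fin N) ℂ)‖ ≤ 1 ∧ ‖(((g x)⁻¹ : (Matrix (Fin N) (Fin N) ℂ)ˣ) : Matrix (Fin N) (Fin N) ℂ)‖ ≤ 1 := by
  letI : CStarAlgebra (Matrix (Fin N) (Fin N) ℂ) := {}
  exact fun x => unitaryUnits_le_U1 (hu x)

/-- **`hR` FROM UNITARITY**: the rotations `R(Uᵘ_μ(z))^{±1}` of a unitary-valued configuration under a unitary-valued gauge are contractions.
[cite: Balaban1985BackgroundPropagators, (3.28) p.395, (3.35) p.396 (G-valued), bookkeeping] -/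
theorem hR_of_unitary (i : KIdx d ℓ hd hL b₀ b₁) {g : GaugeY (Matrix (Fin N) (Fin N) ℂ) i} {U : CfgY (Matrix (Fin N) (Fin N) ℂ) i}
    (hu : ∀ x, g x ∈ unitaryUnits (Matrix (Fin N) (Fin N) ℂ)) (hU : ∀ μ x, U μ x ∈ unitaryUnits (Matrix (Fin N) (Fin N) ℂ)) :
    ∀ (μ : Fin (d + 1)) (z : SiteY i) (a : Matrix (Fin N) (Fin N) ℂ),
      ‖R (UboxY i (gaugeY i g U) μ z) a‖ ≤ ‖a‖ ∧ ‖R (UboxY i (gaugeY i g U) μ z)⁻¹ a‖ ≤ ‖a‖ := by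
  letI : CStarAlgebra (Matrix (Fin N) (Fin N) ℂ) := {}
  intro μ z a
  have hm : UboxY i (gaugeY i g U) μ z ∈ unitaryUnits (Matrix (Fin N) (Fin N) ℂ) := by
    show gaugeY i g U μ ((boxEquiv i.hN).symm z) ∈ unitaryUnits (Matrix (Fin N) (Fin N) ℂ)
    rw [Node00.gaugeY_apply]
    exact (unitaryUnits _).mul_mem ((unitaryUnits _).mul_mem (hu _) (hU _ _)) ((unitaryUnits _).inv_mem (hu _))
  exact ⟨norm_R_le_of_mem_unitaryUnits hm a, norm_R_le_of_mem_unitaryUnits ((unitaryUnits _).inv_mem hm) a⟩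

end Unitary

end Literature.MathematicalPhysics.QuantumFieldTheory.Balaban1983to89.B9Cor36GpDirAtMemberBlocks

end
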